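import Literature.AnabelianGeometry.SemiGraphs.SubgroupPresentationStabilizers
import Literature.AnabelianGeometry.SemiGraphs.TreeSystemFixedPoint
import HarnessLib

/-!
# Fixed vertex systems of a coset-graph tower = conjugation into the verticial subgroup ([SemiAnbd] Thm 3.7 (iii) p. 41)

Mochizuki, *Semi-graphs of anabelioids*, Publ. RIMS **42** (2006), §3, proof of Thm. 3.7 (iii), p. 41
("there exists a compatible system of vertices of `𝒢_{∞,j}`, for `j ∈ J`, each of which is fixed by `H`.
Thus … `H` is contained in some verticial subgroup") [cite: MochizukiSemiAnbd2006, Thm 3.7(iii) p.41].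

PROOF-ONLY, pure group theory (cell abc-iut, layer L3, GAP row G-t6g3-2b, sub-row **G2·E1-V**
«vertical growth over a persistent base vertex», seat abc-iut-w4-d080; no definition).  In the
GROUP-THEORETIC MODEL of the Galois tower of trees — abc-iut-w4-d059's coset semi-graphs `P.cosetGraph (K j)`
of a subgroup presentation `P` (verticial subgroups `H_w ≤ Γ`) at normal levels `K_j ↓`, with the deck
action of `Γ` (the model that abc-iut-L3-t9's dictionary `treeCosetIso` identifies with the canonical trees
`𝒢_{∞,n}` of `π₁^temp(𝒢)`, `Γ = π₁^temp(𝒢)`, `K_n = ker ρ_n`) — the first clause `hfix` of the fixed-systems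
input (FIX∞) of bricks B1–B3 (`TemperedCompactInVerticialOfFixedSystems.lean`,
`TemperedCompactInVerticialAtOfFixedSystems.lean`) for a subgroup `C ≤ Γ` reads, level by level and in the
limit, as CONJUGATION INTO `H_w`:

* `SubgroupPresentation.fixes_vMk_of_conj_mem` / `exists_fixed_vMk_iff` — at ONE level `K`: `C` fixes some
  vertex class over `w` iff some conjugate `y C y⁻¹` lies in `H_w · K` («`C` is conjugate into `H_w`
  MODULO the level», from abc-iut-w4-d059's `deckAct_fixes_vMk_iff`);
* `SubgroupPresentation.compatibleFixedSystem_of_conj_le` — a conjugate `y C y⁻¹ ≤ H_w` gives the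
  compatible `C`-fixed vertex system `(H_w y K_j)_j`;
* `SubgroupPresentation.exists_conj_le_of_compatibleFixedSystem` — conversely, under the two-sided tower
  hypotheses `hHK` (`⋂_j H_w·K_j = H_w`; tempered case: `H_w` compact, abc-iut-w4-d085's `hHK_of_isCompact`)
  and `hlift` (compatible double cosets lift; tempered case: completeness + Kőnig, abc-iut-w4-d085's
  `hlift_of_complete`), a compatible `C`-fixed vertex system over `w` yields `y` with `y C y⁻¹ ≤ H_w`
  (abc-iut-w4-d059's (I2) two-sided `exists_rep_and_stabilizer_of_compatible`);
* `SubgroupPresentation.exists_conj_le_of_finite_fixed` — **G2·E1-V in the model**: if at every level the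
  `C`-fixed vertex classes over `w` are FINITELY many and some exists, then `y C y⁻¹ ≤ H_w` for some `y`
  (Kőnig, abc-iut-L3-t6's `SemiGraph.exists_compatible_of_finite`, then the previous item).

CONSEQUENCE FOR THE OPEN CORE (recorded, NOT claimed): in this model the residual of G2·E1-V («persistent
base vertex ⇒ hfix») is EXACTLY the tempered LOCAL–GLOBAL CONJUGACY statement
  «(∀ j, ∃ y_j, y_j C y_j⁻¹ ⊆ H_w · K_j) ⟹ (∃ y, y C y⁻¹ ⊆ H_w)»
for compact `C`, `H_w` in the complete, non-locally-compact `Γ = π₁^temp(𝒢)` — automatic when the conjugators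
can be taken in a compact set, and when the fixed classes are finite cofinally (this file); OPEN in the drift
regime (infinitely many fixed classes = nontrivial centralisers of `C` in the deck groups at every level).
Nothing here asserts it; nothing bears on [IUTchIII] Cor. 3.12.
-/

namespace Literature.AnabelianGeometry.SemiGraphs

namespace SemiGraph

namespace SubgroupPresentation

open CategoryTheory
open scoped Pointwise

universe v u

variable {𝔾 : SemiGraph.{u}} {Γ : Type u} [Group Γ] (P : SubgroupPresentation 𝔾 Γ)

/-! ### One level: fixed vertex classes over `w` = conjugation into `H_w · K` -/

section OneLevel

variable (K : Subgroup Γ) [K.Normal]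

/-- If `y C y⁻¹ ⊆ H_w · K` then `C` fixes the vertex class `H_w y K` (abc-iut-w4-d059's criterion
`deckAct_fixes_vMk_iff`, read for a whole subgroup). [cite: MochizukiSemiAnbd2006, Thm 3.7(iii) p.41] -/
theorem fixes_vMk_of_conj_mem (C : Subgroup Γ) (w : 𝔾.Vertex) (y : Γ)
    (h : ∀ g ∈ C, y * g * y⁻¹ ∈ (P.H w : Set Γ) * (K : Set Γ)) :
    ∀ g ∈ C, (P.deckAct K g).hom.vertexMap (P.vMk K w y) = P.vMk K w y :=
  fun g hg => (P.deckAct_fixes_vMk_iff K g w y).mpr (h g hg)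

/-- **At one level, `C` fixes a vertex class over `w` iff a conjugate of `C` lies in `H_w · K`** («`C` is
conjugate into the verticial subgroup MODULO the level `K`»): every vertex over `w` is a class `H_w y K`
(`vMk_surjective`) and `g` fixes it iff `y g y⁻¹ ∈ H_w · K`. [cite: MochizukiSemiAnbd2006, Thm 3.7(iii) p.41] -/
theorem exists_fixed_vMk_iff (C : Subgroup Γ) (w : 𝔾.Vertex) :
    (∃ y : Γ, ∀ g ∈ C, (P.deckAct K g).hom.vertexMap (P.vMk K w y) = P.vMk K w y) ↔
      ∃ y : Γ, ∀ g ∈ C, y * g * y⁻¹ ∈ (P.H w : Set Γ) * (K : Set Γ) := by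
  constructor
  · rintro ⟨y, hy⟩
    exact ⟨y, fun g hg => (P.deckAct_fixes_vMk_iff K g w y).mp (hy g hg)⟩
  · rintro ⟨y, hy⟩
    exact ⟨y, P.fixes_vMk_of_conj_mem K C w y hy⟩

end OneLevel

/-! ### The tower: compatible fixed systems over `w` = conjugation into `H_w` -/

section Tower

variable {J : Type v} [Preorder J] (K : J → Subgroup Γ) [∀ j, (K j).Normal]
  (hK : ∀ ⦃i j : J⦄, i ≤ j → K j ≤ K i)

/-- Membership in `H.map (conj y⁻¹) = y⁻¹ H y`. [folklore] -/
private theorem mem_map_conj_inv_iff' (H : Subgroup Γ) (y g : Γ) :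
    g ∈ H.map (MulAut.conj y⁻¹).toMonoidHom ↔ y * g * y⁻¹ ∈ H := by
  constructor
  · rintro ⟨h, hh, rfl⟩
    simpa [MulAut.conj_apply, mul_assoc] using hh
  · intro hg
    exact ⟨y * g * y⁻¹, hg, by simp [mul_assoc]⟩

/-- **A conjugate inside the verticial subgroup gives a compatible fixed system**: if `y C y⁻¹ ≤ H_w`
then the vertex classes `(H_w y K_j)_j` form a compatible system of the coset-graph tower, each fixed by
`C` (abc-iut-w4-d059's (I1) two-sided; only its trivial direction is used, so no tower hypothesis is
needed). [cite: MochizukiSemiAnbd2006, Thm 3.7(iii) p.41] -/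
theorem compatibleFixedSystem_of_conj_le (C : Subgroup Γ) (w : 𝔾.Vertex) (y : Γ)
    (hC : ∀ g ∈ C, y * g * y⁻¹ ∈ P.H w) :
    (∀ ⦃i j : J⦄ (h : i ≤ j), (P.cosetGraphTrans (hK h)).vertexMap (P.vMk (K j) w y) = P.vMk (K i) w y) ∧
      ∀ g ∈ C, ∀ j, (P.deckAct (K j) g).hom.vertexMap (P.vMk (K j) w y) = P.vMk (K j) w y :=
  ⟨fun _ _ _ => rfl, fun g hg j => (P.deckAct_fixes_vMk_iff (K j) g w y).mpr
    (Set.mem_mul.mpr ⟨_, hC g hg, 1, (K j).one_mem, mul_one _⟩)⟩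

/-- **A compatible `C`-fixed vertex system over `w` gives a conjugate inside `H_w`** — under the two-sided
tower hypotheses `hHK` (`⋂_j H_w · K_j = H_w`; tempered case: `H_w` compact, `K_j` open with trivial
intersection) and `hlift` (compatible double cosets have a common representative; tempered case:
completeness of `π₁^temp` for the levels and Kőnig): the system is `(H_w y K_j)_j` for ONE `y`
(abc-iut-w4-d059's `exists_rep_and_stabilizer_of_compatible`), its stabiliser is exactly `y⁻¹ H_w y`, and it
contains `C`.  In the canonical tower this is the content of print's "Thus … `H` is contained in some
verticial subgroup". [cite: MochizukiSemiAnbd2006, Thm 3.7(iii) p.41] -/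
theorem exists_conj_le_of_compatibleFixedSystem [IsDirectedOrder J] [Nonempty J]
    (hHK : ∀ (w : 𝔾.Vertex) (x : Γ), (∀ j, x ∈ (P.H w : Set Γ) * (K j : Set Γ)) → x ∈ P.H w)
    (hlift : ∀ (w : 𝔾.Vertex) (y : J → Γ),
      (∀ ⦃i j : J⦄, i ≤ j → DoubleCoset.mk (P.H w) (K i) (y j) = DoubleCoset.mk (P.H w) (K i) (y i)) →
      ∃ z : Γ, ∀ j, DoubleCoset.mk (P.H w) (K j) z = DoubleCoset.mk (P.H w) (K j) (y j))
    (C : Subgroup Γ) (x : ∀ j, (P.cosetGraph (K j)).Vertex)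
    (hx : ∀ ⦃i j : J⦄ (h : i ≤ j), (P.cosetGraphTrans (hK h)).vertexMap (x j) = x i)
    (hfix : ∀ g ∈ C, ∀ j, (P.deckAct (K j) g).hom.vertexMap (x j) = x j) :
    ∃ (w : 𝔾.Vertex) (y : Γ), (∀ j, x j = P.vMk (K j) w y) ∧ ∀ g ∈ C, y * g * y⁻¹ ∈ P.H w := by
  obtain ⟨w, y, hxy, hstab⟩ := P.exists_rep_and_stabilizer_of_compatible K hK hHK hlift x hx
  refine ⟨w, y, hxy, fun g hg => ?_⟩
  exact (mem_map_conj_inv_iff' (P.H w) y g).mp ((hstab g).mp (hfix g hg))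

include hK in
/-- **G2·E1-V in the group-theoretic model: finitely many fixed classes at every level give a conjugate
inside the verticial subgroup.**  If, at every level `j`, some vertex class over `w` is fixed by `C` and only
FINITELY many vertices of `P.cosetGraph (K j)` over `w` are fixed by `C`, then — under `hHK` and `hlift` —
`y C y⁻¹ ≤ H_w` for some `y` (Kőnig over the directed levels, abc-iut-L3-t6's
`SemiGraph.exists_compatible_of_finite`, on the trans-stable finite family of `C`-fixed vertices over `w`;
then `exists_conj_le_of_compatibleFixedSystem`).  The hypothesis «finitely many fixed classes» fails exactly
when `C` centralises, modulo the level, a nontrivial deck transformation — the open drift regime of GAP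
G-t6g3-2b. [cite: MochizukiSemiAnbd2006, Thm 3.7(iii) p.41] -/
theorem exists_conj_le_of_finite_fixed [IsDirectedOrder J] [Nonempty J]
    (hHK : ∀ (w : 𝔾.Vertex) (x : Γ), (∀ j, x ∈ (P.H w : Set Γ) * (K j : Set Γ)) → x ∈ P.H w)
    (hlift : ∀ (w : 𝔾.Vertex) (y : J → Γ),
      (∀ ⦃i j : J⦄, i ≤ j → DoubleCoset.mk (P.H w) (K i) (y j) = DoubleCoset.mk (P.H w) (K i) (y i)) →
      ∃ z : Γ, ∀ j, DoubleCoset.mk (P.H w) (K j) z = DoubleCoset.mk (P.H w) (K j) (y j))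
    (C : Subgroup Γ) (w : 𝔾.Vertex)
    (hne : ∀ j, ∃ y : Γ, ∀ g ∈ C, (P.deckAct (K j) g).hom.vertexMap (P.vMk (K j) w y) = P.vMk (K j) w y)
    (hfin : ∀ j, {x : (P.cosetGraph (K j)).Vertex | x.1 = w ∧
      ∀ g ∈ C, (P.deckAct (K j) g).hom.vertexMap x = x}.Finite) :
    ∃ y : Γ, ∀ g ∈ C, y * g * y⁻¹ ∈ P.H w := by
  -- the trans-stable family of `C`-fixed vertices over `w`
  let F : ∀ j, Set (P.cosetGraph (K j)).Vertex := fun j =>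
    {x | x.1 = w ∧ ∀ g ∈ C, (P.deckAct (K j) g).hom.vertexMap x = x}
  have hmap : ∀ ⦃i j : J⦄ (h : i ≤ j) (x : (P.cosetGraph (K j)).Vertex), x ∈ F j →
      (P.cosetGraphTrans (hK h)).vertexMap x ∈ F i := by
    rintro i j h x ⟨hxw, hxf⟩
    obtain ⟨w', y, rfl⟩ := P.vMk_surjective (K j) x
    cases hxw
    refine ⟨rfl, fun g hg => ?_⟩
    have hj := (P.deckAct_fixes_vMk_iff (K j) g w' y).mp (hxf g hg)
    obtain ⟨a, ha, k, hk, hak⟩ := Set.mem_mul.mp hj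
    exact (P.deckAct_fixes_vMk_iff (K i) g w' y).mpr (Set.mem_mul.mpr ⟨a, ha, k, hK h hk, hak⟩)
  -- Kőnig over the directed levels
  obtain ⟨x, hxA, hxc⟩ := SemiGraph.exists_compatible_of_finite
    (fun i j (h : i ≤ j) => (P.cosetGraphTrans (hK h)).vertexMap)
    (fun j x => by rw [P.cosetGraphTrans_refl]; rfl)
    (fun i j k hij hjk x => by
      have e := congrArg (fun φ => SemiGraph.Hom.vertexMap φ x) (P.cosetGraphTrans_comp (hK hjk) (hK hij))
      simpa only [SemiGraph.comp_vertexMap, Function.comp_apply] using e)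
    F hfin (fun j => let ⟨y, hy⟩ := hne j; ⟨P.vMk (K j) w y, rfl, hy⟩) hmap
  obtain ⟨w', y, hxy, hy⟩ :=
    P.exists_conj_le_of_compatibleFixedSystem K hK hHK hlift C x hxc (fun g hg j => (hxA j).2 g hg)
  obtain ⟨j₀⟩ := ‹Nonempty J›
  have hw : w' = w := by
    have h1 : (x j₀).1 = w := (hxA j₀).1
    rw [hxy j₀] at h1
    exact h1
  subst hw
  exact ⟨y, hy⟩

end Tower

end SubgroupPresentation

end SemiGraph

end Literature.AnabelianGeometry.SemiGraphs
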